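import Summits.Ventures.PercRepro.Night2RigidTargets

/-!
# PercRepro — the rigid cell: the loss mass of a target (night-2, gen 18)

In the rigid cell (`|E ∖ G| = q − 1`, `kColoops = q − 2`, `M` simple) the losses sit at the pairs
`B = K ∪ {x, y}` (`loss_eq_zero_of_three_le`), each at most `λ` (`loss_le_lambda`), and every pair has
`2^{n−3} − 1` targets (`card_tgtSets`, `n = |G ∖ K|`).  The pairs `(B, z)` whose loss targets a shadow set
`S = K ∪ P` inject into the pointed triples `(T, w)`, `T ⊆ P`, `|T| = 3`, `w ∈ T` (`T = (B ∖ K) ∪ {z}`), so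
**`pi2Mass_le_rigid`**: `pi2Mass S ≤ 3·C(|P|, 3)·λ/(2^{n−3} − 1)` — paper §7, «targets and the mass».
-/

namespace PercRepro.Shadow

open Finset PerFlat ThmH

variable {α : Type*} [DecidableEq α] {M : Matroid α} [M.Finite]

open scoped Classical in
/-- The pointed pairs of losses targeting `S`: the `(B, z)` with `B` a thin member, `z ∈ G ∖ cl B`, `S` a target. -/
noncomputable def lossPairsAt (M : Matroid α) [M.Finite] (q : ℕ) (G S : Finset α) :
    Finset (Finset α × α) :=
  ((thinMembers M q G).sigma (fun B => G \ clF M B)).image (fun x => (x.1, x.2)) |>.filter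
    (fun p => S ∈ tgtSets M q G p.1 p.2)

open scoped Classical in
/-- `pi2Mass S` as a sum over `lossPairsAt`. -/
theorem pi2Mass_eq_sum_lossPairsAt (q : ℕ) (G S : Finset α) :
    pi2Mass M q G S = ∑ p ∈ lossPairsAt M q G S, rhoL M q G p.1 p.2 := by
  unfold pi2Mass lossPairsAt
  have hinj : ∀ x ∈ (thinMembers M q G).sigma (fun B => G \ clF M B),
      ∀ y ∈ (thinMembers M q G).sigma (fun B => G \ clF M B),
      (fun x : (Σ _ : Finset α, α) => (x.1, x.2)) x = (fun x : (Σ _ : Finset α, α) => (x.1, x.2)) y → x = y := by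
    intro x _ y _ hxy
    simp only [Prod.mk.injEq] at hxy
    exact Sigma.ext hxy.1 (heq_of_eq hxy.2)
  rw [Finset.sum_filter, Finset.sum_image hinj, Finset.sum_sigma]

/-- A thin member with `|B ∖ K| = 2` has `|G ∖ (B ∪ {z})| = n − 3` with `n = |G| − kColoops`. -/
theorem card_sdiff_insert_eq {q : ℕ} {G : Finset α} (hG : G ∈ flatsQ M (q + 1)) (hd : (gr M \ G).card ≤ q)
    {B : Finset α} (hB : B ∈ thinMembers M q G)
    (h2 : (B \ coloops M G).card = 2) {z : α} (hz : z ∈ G \ clF M B) :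
    (G \ insert z B).card = (G.card - kColoops M G) - 3 := by
  have hB' : B ∈ membersIn M (Uq M (q + 2) q) G := (mem_thinMembers.1 hB).1
  have hBU : B ∈ Uq M (q + 2) q := (mem_membersIn.1 hB').1
  have hBG : B ⊆ G := (subset_clF hBU).trans (mem_membersIn.1 hB').2
  have hK := coloops_subset_of_mem_thinMembers hG hd hB
  have hzB : z ∉ B := notMem_of_notMem_clF hBU (Finset.mem_sdiff.1 hz).2
  have hzG : z ∈ G := (Finset.mem_sdiff.1 hz).1
  have hBcard : B.card = kColoops M G + 2 := by
    rw [kColoops_eq_card_coloops, ← h2, ← Finset.card_union_of_disjoint Finset.disjoint_sdiff,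
      Finset.union_sdiff_of_subset hK]
  rw [Finset.card_sdiff_of_subset (Finset.insert_subset hzG hBG), Finset.card_insert_of_notMem hzB, hBcard]
  omega

open scoped Classical in
/-- The loss pairs targeting `S` with a positive weight are pairs `B = K ∪ {x, y}`. -/
theorem card_sdiff_eq_two_of_rhoL_ne_zero {q : ℕ} {G : Finset α} (hG : G ∈ flatsQ M (q + 1))
    (hd : (gr M \ G).card = q - 1) (hk : kColoops M G + 2 = q)
    (hs : ∀ e ∈ gr M, ∀ f ∈ gr M, e ≠ f → rkN M {e, f} = 2) {B : Finset α} (hB : B ∈ thinMembers M q G)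
    {z : α} (hz : z ∈ G \ clF M B) (hρ : rhoL M q G B z ≠ 0) : (B \ coloops M G).card = 2 := by
  have hd' : (gr M \ G).card ≤ q := by omega
  have hl : loss M q G B z ≠ 0 := by
    intro h; apply hρ; unfold rhoL; rw [h, zero_div]
  by_contra hne
  -- |B ∖ K| ≥ 2 always (rank 2); ≠ 2 means ≥ 3
  have h2 : 2 ≤ (B \ coloops M G).card := by
    have hr := eRk_sdiff_coloops_eq_two hG hd' hk hB
    have hle : M.eRk ((B \ coloops M G : Finset α) : Set α) ≤ ((B \ coloops M G).card : ℕ∞) := by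
      calc M.eRk ((B \ coloops M G : Finset α) : Set α) ≤ ((B \ coloops M G : Finset α) : Set α).encard :=
            M.eRk_le_encard _
        _ = ((B \ coloops M G).card : ℕ∞) := by rw [Set.encard_coe_eq_coe_finsetCard]
    rw [hr] at hle
    exact_mod_cast hle
  have h3 : 3 ≤ (B \ coloops M G).card := by omega
  exact hl (loss_eq_zero_of_three_le hG hd hk hs hB h3 hz)

open scoped Classical in
/-- The injection of a loss pair into a pointed triple of `S ∖ K`. -/
theorem lossPairs_inj {q : ℕ} {G : Finset α} (hG : G ∈ flatsQ M (q + 1)) (hd : (gr M \ G).card ≤ q)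
    {B B' : Finset α} {z z' : α} (hB : B ∈ thinMembers M q G) (hB' : B' ∈ thinMembers M q G)
    (h : insert z (B \ coloops M G) = insert z' (B' \ coloops M G)) (hzz : z = z') (hz : z ∉ B)
    (hz' : z' ∉ B') : B = B' := by
  subst hzz
  have hK := coloops_subset_of_mem_thinMembers hG hd hB
  have hK' := coloops_subset_of_mem_thinMembers hG hd hB'
  have hzK : z ∉ B \ coloops M G := fun hh => hz (Finset.mem_sdiff.1 hh).1
  have hzK' : z ∉ B' \ coloops M G := fun hh => hz' (Finset.mem_sdiff.1 hh).1
  have h1 : B \ coloops M G = B' \ coloops M G := by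
    have := congrArg (fun T => T.erase z) h
    simpa only [Finset.erase_insert hzK, Finset.erase_insert hzK'] using this
  calc B = coloops M G ∪ (B \ coloops M G) := (Finset.union_sdiff_of_subset hK).symm
    _ = coloops M G ∪ (B' \ coloops M G) := by rw [h1]
    _ = B' := Finset.union_sdiff_of_subset hK'

open scoped Classical in
/-- **Rigid cell: the loss mass of a shadow set `S` is at most `3·C(|S ∖ K|, 3)·λ/(2^{n−3} − 1)`.** -/
theorem pi2Mass_le_rigid {q : ℕ} {G : Finset α} (hG : G ∈ flatsQ M (q + 1)) (hd : (gr M \ G).card = q - 1)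
    (hk : kColoops M G + 2 = q) (hs : ∀ e ∈ gr M, ∀ f ∈ gr M, e ≠ f → rkN M {e, f} = 2)
    {S : Finset α} (hS : S ∈ shadowAt M (q + 2) q (Uq M (q + 2) q) G) :
    pi2Mass M q G S ≤
      (3 * ((S \ coloops M G).card.choose 3 : ℚ)) *
        (lambdaR q / ((2 ^ ((G.card - kColoops M G) - 3) - 1 : ℕ) : ℚ)) := by
  have hd' : (gr M \ G).card ≤ q := by omega
  have hSG : S ⊆ G := subset_G_of_mem_shadowAt hS
  rw [pi2Mass_eq_sum_lossPairsAt]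
  -- keep only the pairs with positive weight; they are pairs (|B ∖ K| = 2)
  set r := (G.card - kColoops M G) - 3 with hr
  set w : ℚ := lambdaR q / ((2 ^ r - 1 : ℕ) : ℚ) with hw
  have hw0 : 0 ≤ w := by
    rw [hw]; exact div_nonneg (lambdaR_pos (by omega)).le (by positivity)
  have hterm : ∀ p ∈ lossPairsAt M q G S, rhoL M q G p.1 p.2 ≤
      if rhoL M q G p.1 p.2 = 0 then 0 else w := by
    intro p hp
    split_ifs with h0
    · rw [h0]
    · unfold lossPairsAt at hp
      rw [Finset.mem_filter, Finset.mem_image] at hp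
      obtain ⟨⟨x, hx, rfl⟩, hpS⟩ := hp
      rw [Finset.mem_sigma] at hx
      obtain ⟨hB, hz⟩ := hx
      have h2 := card_sdiff_eq_two_of_rhoL_ne_zero hG hd hk hs hB hz h0
      unfold rhoL
      rw [card_tgtSets hG (mem_thinMembers.1 hB).1 hz, card_sdiff_insert_eq hG hd' hB h2 hz, ← hr, hw]
      apply div_le_div_of_nonneg_right _ (by positivity)
      exact loss_le_lambda hG hd hk hB h2 hz
  calc ∑ p ∈ lossPairsAt M q G S, rhoL M q G p.1 p.2
      ≤ ∑ p ∈ lossPairsAt M q G S, (if rhoL M q G p.1 p.2 = 0 then 0 else w) := Finset.sum_le_sum hterm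
    _ = ((lossPairsAt M q G S).filter (fun p => rhoL M q G p.1 p.2 ≠ 0)).card * w := by
        rw [Finset.sum_ite, Finset.sum_const_zero, zero_add, Finset.sum_const, nsmul_eq_mul]
    _ ≤ (3 * ((S \ coloops M G).card.choose 3 : ℚ)) * w := by
        apply mul_le_mul_of_nonneg_right _ hw0
        -- inject into the pointed triples of S ∖ K
        have hinj : ((lossPairsAt M q G S).filter (fun p => rhoL M q G p.1 p.2 ≠ 0)).card ≤
            (((S \ coloops M G).powersetCard 3).sigma (fun T => T)).card := by
          apply Finset.card_le_card_of_injOn (fun p => ⟨insert p.2 (p.1 \ coloops M G), p.2⟩)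
          · intro p hp
            rw [Finset.mem_coe, Finset.mem_filter] at hp
            obtain ⟨hp, hρ⟩ := hp
            unfold lossPairsAt at hp
            rw [Finset.mem_filter, Finset.mem_image] at hp
            obtain ⟨⟨x, hx, rfl⟩, hpS⟩ := hp
            rw [Finset.mem_sigma] at hx
            obtain ⟨hB, hz⟩ := hx
            have h2 := card_sdiff_eq_two_of_rhoL_ne_zero hG hd hk hs hB hz hρ
            have hB' : x.1 ∈ membersIn M (Uq M (q + 2) q) G := (mem_thinMembers.1 hB).1
            have hBU : x.1 ∈ Uq M (q + 2) q := (mem_membersIn.1 hB').1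
            have hzB : x.2 ∉ x.1 := notMem_of_notMem_clF hBU (Finset.mem_sdiff.1 hz).2
            have hzK : x.2 ∉ x.1 \ coloops M G := fun hh => hzB (Finset.mem_sdiff.1 hh).1
            have hsub : insert x.2 x.1 ⊆ S := (mem_tgtSets.1 hpS).2.1
            rw [Finset.mem_coe, Finset.mem_sigma, Finset.mem_powersetCard]
            refine ⟨⟨?_, ?_⟩, Finset.mem_insert_self _ _⟩
            · intro y hy
              rw [Finset.mem_insert] at hy
              rw [Finset.mem_sdiff]
              rcases hy with rfl | hy
              · refine ⟨hsub (Finset.mem_insert_self _ _), ?_⟩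
                intro hzc
                exact hzB (coloops_subset_of_mem_thinMembers hG hd' hB hzc)
              · rw [Finset.mem_sdiff] at hy
                exact ⟨hsub (Finset.mem_insert_of_mem hy.1), hy.2⟩
            · rw [Finset.card_insert_of_notMem hzK, h2]
          · intro p hp p' hp' heq
            rw [Finset.mem_coe, Finset.mem_filter] at hp hp'
            obtain ⟨hp, -⟩ := hp
            obtain ⟨hp', -⟩ := hp'
            unfold lossPairsAt at hp hp'
            rw [Finset.mem_filter, Finset.mem_image] at hp hp'
            obtain ⟨⟨x, hx, rfl⟩, -⟩ := hp
            obtain ⟨⟨x', hx', rfl⟩, -⟩ := hp'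
            rw [Finset.mem_sigma] at hx hx'
            simp only [Sigma.mk.injEq] at heq
            obtain ⟨hT, hzz⟩ := heq
            have hzz' : x.2 = x'.2 := eq_of_heq hzz
            have hBU : x.1 ∈ Uq M (q + 2) q := (mem_membersIn.1 (mem_thinMembers.1 hx.1).1).1
            have hBU' : x'.1 ∈ Uq M (q + 2) q := (mem_membersIn.1 (mem_thinMembers.1 hx'.1).1).1
            have hB := lossPairs_inj hG hd' hx.1 hx'.1 hT hzz'
              (notMem_of_notMem_clF hBU (Finset.mem_sdiff.1 hx.2).2)
              (notMem_of_notMem_clF hBU' (Finset.mem_sdiff.1 hx'.2).2)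
            exact Prod.ext hB hzz'
        have hcount : (((S \ coloops M G).powersetCard 3).sigma (fun T => T)).card =
            3 * (S \ coloops M G).card.choose 3 := by
          rw [Finset.card_sigma]
          have : ∀ T ∈ (S \ coloops M G).powersetCard 3, T.card = 3 :=
            fun T hT => (Finset.mem_powersetCard.1 hT).2
          rw [Finset.sum_congr rfl this, Finset.sum_const, Finset.card_powersetCard, smul_eq_mul, mul_comm]
        have := hinj.trans hcount.le
        exact_mod_cast this

end PercRepro.Shadow
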